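import Summits.CriticalPhenomena.PercolationContinuityZ3.Theorems.PercNearOneGluingNoHeavyLowerTailSwitchRelaxCheck
import HarnessLib

/-!
# `NoHeavyLowerTail` (stmt-CriticalPhenomena-4575) — FOUR-copy switching certificates, II: per-letter avoidance
# options, X-block representatives, and the admissible output lists of the type-level relaxation

Support file (prover prim-ineq-prove-3 gen 8; `--supports stmt-CriticalPhenomena-4575`).  No named facts, no sorries.

This is the per-copy bookkeeping of the FINITE RELAXATION used by the four-copy "hub" certificate checker (part III),
built on prim-cert-2's type calculus (`…SwitchRelaxSemantics`: `ftype`, `jn`, `refines`, `inW`, `admClean`, `admMessy`;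
`…SwitchRelaxCheck`: `rootOK`, `realP`).  All roots are single terminals `u : Fin 4`; a copy `T` of base type `t` is
abstracted, for every root letter `u`, by the avoidance type `p_u = ftype (T ∖ touch (cl X (τ u)))`, and letters in one
`X`-block share their avoidance type, so a state assigns an option only to the REPRESENTATIVE `rep πX u` of each block:
* `rep`, `jn_rep`, `rep_rep` — least letter of the `πX`-block; `opts πX t u` — avoidance types allowed for root `u`
  (`refines p t ∧ rootOK`), `realP_mem_opts`;
* `cleanL πX u p` / `messyL πX u v t p` — the admissible output types of a sealed first step rooted at `u` / of a second
  step rooted at `v` after `u` (filters of `admClean` / `admMessy`), with `ftype_first_mem_cleanL`, `ftype_second_mem_messyL`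
  (the real outputs are admissible, read at the representative's avoidance type);
* `St4`, `states πX t` — all assignments of options to the free letters, `realSt4`, `proj_realSt4_mem_states`.
-/

noncomputable section

namespace Summit.CriticalPhenomena.PercolationContinuityZ3.Theorems

namespace FourCopyHub

open Finset Literature.Probability.Percolation Literature.Probability.Percolation.DecisionTree
open Literature.Probability.Percolation.Gladkov ThreePointLB GroupThreePointLB FourPointAtoms SwitchRelax
open scoped Classical

/-! ### Block representatives -/

/-- The least letter of the `πX`-block of `u`. [this work] -/
def rep (πX : Ty) (u : Fin 4) : Fin 4 :=
  if jn πX 0 u then 0 else if jn πX 1 u then 1 else if jn πX 2 u then 2 else u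

/-- `rep πX u` lies in the block of `u`. [this work] -/
theorem jn_rep (πX : Ty) (u : Fin 4) : jn πX (rep πX u) u = true := by
  unfold rep
  split_ifs with h0 h1 h2
  · exact h0
  · exact h1
  · exact h2
  · simp [jn]

/-- `jn` is symmetric. [folklore] -/
theorem jn_comm (t : Ty) (i j : Fin 4) : jn t i j = jn t j i := by
  simp only [jn, eq_comm]

/-- `jn` is transitive. [folklore] -/
theorem jn_trans {t : Ty} {i j k : Fin 4} (h : jn t i j = true) (h' : jn t j k = true) : jn t i k = true := by
  simp only [jn, decide_eq_true_iff] at h h' ⊢; exact h.trans h'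

/-- Letters of one block have the same representative (finite check over the 15 types). [this work] -/
theorem rep_eq_rep_of_jn : ∀ {πX : Ty} {u w : Fin 4}, jn πX u w = true → rep πX u = rep πX w := by decide

/-- The representative is a fixed point. [this work] -/
theorem rep_rep (πX : Ty) (u : Fin 4) : rep πX (rep πX u) = rep πX u :=
  rep_eq_rep_of_jn (jn_rep πX u)

/-- `free πX u`: `u` is the representative of its block. [this work] -/
def free (πX : Ty) (u : Fin 4) : Bool := decide (rep πX u = u)

/-! ### Options and admissible output lists -/

/-- Avoidance types allowed for a copy of base type `t` and root letter `u`. [this work] -/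
def opts (πX t : Ty) (u : Fin 4) : List Ty := allTys.filter fun p => refines p t && rootOK πX {u} p

/-- Admissible CLEAN output types of a first step rooted at `u` (the copy's avoidance type for `u` being `p`). [this work] -/
def cleanL (πX : Ty) (u : Fin 4) (p : Ty) : List Ty := allTys.filter fun q => admClean πX (inW πX {u}) p q

/-- Admissible MESSY output types of a second step rooted at `v` after a first step rooted at `u`, for a copy of base type
`t` whose avoidance type for `v` is `p`. [this work] -/
def messyL (πX : Ty) (u v : Fin 4) (t p : Ty) : List Ty := allTys.filter fun q => admMessy πX (inW πX {u}) v t p q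

/-! ### States: one option per free letter -/

/-- A refined state of one copy: an avoidance type for each root letter (only representatives are read). [this work] -/
abbrev St4 := Fin 4 → Ty

/-- Build a state from four values. [this work] -/
def mk4 (p0 p1 p2 p3 : Ty) : St4 := fun i => if i = 0 then p0 else if i = 1 then p1 else if i = 2 then p2 else p3

/-- Options of letter `u` in a state listing: the real options for a free letter, the single placeholder `0` otherwise. [this work] -/
def optsF (πX t : Ty) (u : Fin 4) : List Ty := if free πX u then opts πX t u else [0]

/-- All states of a copy of base type `t`: every free letter gets an option, other letters the placeholder. [this work] -/
def states (πX t : Ty) : List St4 :=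
  (optsF πX t 0).flatMap fun p0 => (optsF πX t 1).flatMap fun p1 => (optsF πX t 2).flatMap fun p2 =>
    (optsF πX t 3).map fun p3 => mk4 p0 p1 p2 p3

/-- Projection of a state to the listed form (placeholder at non-free letters). [this work] -/
def proj (πX : Ty) (s : St4) : St4 := fun u => if free πX u then s u else 0

/-- Membership in `states`. [this work] -/
theorem mk4_mem_states {πX t : Ty} {p0 p1 p2 p3 : Ty} (h0 : p0 ∈ optsF πX t 0) (h1 : p1 ∈ optsF πX t 1)
    (h2 : p2 ∈ optsF πX t 2) (h3 : p3 ∈ optsF πX t 3) : mk4 p0 p1 p2 p3 ∈ states πX t := by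
  simp only [states, List.mem_flatMap, List.mem_map]
  exact ⟨p0, h0, p1, h1, p2, h2, p3, h3, rfl⟩

/-- A projected state is listed as soon as its values at free letters are options. [this work] -/
theorem proj_mem_states {πX t : Ty} {s : St4} (h : ∀ u, free πX u = true → s u ∈ opts πX t u) :
    proj πX s ∈ states πX t := by
  have hf : ∀ u, proj πX s u ∈ optsF πX t u := fun u => by
    unfold proj optsF
    cases hu : free πX u
    · simp
    · simp only [if_true]; exact h u hu
  have e : proj πX s = mk4 (proj πX s 0) (proj πX s 1) (proj πX s 2) (proj πX s 3) := by
    funext i; fin_cases i <;> rfl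
  rw [e]; exact mk4_mem_states (hf 0) (hf 1) (hf 2) (hf 3)

/-- Reading a projected state at a representative. [this work] -/
theorem proj_rep (πX : Ty) (s : St4) (u : Fin 4) : proj πX s (rep πX u) = s (rep πX u) := by
  simp [proj, free, rep_rep]

/-! ### The real state of a copy and admissibility of the real outputs -/

section Real

variable {V : Type*} [Fintype V] [DecidableEq V] (τ : Fin 4 → V)

/-- The real refined state of copy `T` under source `X`: letter `u ↦ ftype (T ∖ touch (cl X (τ u)))`. [this work] -/
def realSt4 (X T : Finset (Sym2 V)) : St4 := fun u => realP τ X T {u}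

omit [Fintype V] in
/-- Roots of a singleton. [folklore] -/
theorem roots_singleton (u : Fin 4) : roots τ ({u} : Finset (Fin 4)) = {τ u} := by simp [roots]

/-- Letters of one `X`-block explore the same cluster. [this work] -/
theorem clS_roots_eq_of_jn {X : Finset (Sym2 V)} {u w : Fin 4} (h : jn (ftype τ X) u w = true) :
    clS X (roots τ {w}) = clS X (roots τ {u}) := by
  rw [roots_singleton, roots_singleton, clS_singleton, clS_singleton]
  exact cl_eq_cl_of_mem ((jn_ftype_iff τ X u w).1 h)

/-- The real avoidance type is the same for all letters of a block; in particular at the representative. [this work] -/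
theorem realSt4_rep (X T : Finset (Sym2 V)) (u : Fin 4) :
    realSt4 τ X T (rep (ftype τ X) u) = realSt4 τ X T u := by
  simp only [realSt4, realP, clS_roots_eq_of_jn τ (jn_rep (ftype τ X) u)]

/-- The mask of a letter equals the mask of its representative. [this work] -/
theorem inW_rep (X : Finset (Sym2 V)) (u : Fin 4) : inW (ftype τ X) {rep (ftype τ X) u} = inW (ftype τ X) {u} := by
  funext i
  rw [Bool.eq_iff_iff, inW_ftype_iff, inW_ftype_iff, clS_roots_eq_of_jn τ (jn_rep (ftype τ X) u)]

/-- The real avoidance types are options. [this work] -/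
theorem realP_mem_opts (X T : Finset (Sym2 V)) (u : Fin 4) : realP τ X T {u} ∈ opts (ftype τ X) (ftype τ T) u := by
  unfold opts
  rw [List.mem_filter]
  refine ⟨mem_allTys _, ?_⟩
  have h := okLocal_real τ X T [] {u}
  simp only [okLocal, Bool.and_eq_true] at h
  rw [Bool.and_eq_true]; exact h.1

/-- The projected real state is listed. [this work] -/
theorem proj_realSt4_mem_states (X T : Finset (Sym2 V)) :
    proj (ftype τ X) (realSt4 τ X T) ∈ states (ftype τ X) (ftype τ T) :=
  proj_mem_states fun u _ => realP_mem_opts τ X T u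

/-- **The real first (clean) output is admissible**, read at the representative's avoidance type. [this work] -/
theorem ftype_first_mem_cleanL (X T : Finset (Sym2 V)) (u : Fin 4) :
    ftype τ (splice (touch (clS X (roots τ {u}))) X T) ∈
      cleanL (ftype τ X) u (proj (ftype τ X) (realSt4 τ X T) (rep (ftype τ X) u)) := by
  unfold cleanL
  rw [List.mem_filter, proj_rep, realSt4_rep]
  exact ⟨mem_allTys _, admClean_ftype τ X T {u}⟩

/-- **The real second (messy) output is admissible**, read at the representative's avoidance type. [this work] -/
theorem ftype_second_mem_messyL (X T : Finset (Sym2 V)) (u v : Fin 4) :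
    ftype τ (splice (touch (clS X (roots τ {v})) \ touch (clS X (roots τ {u}))) X T) ∈
      messyL (ftype τ X) u v (ftype τ T) (proj (ftype τ X) (realSt4 τ X T) (rep (ftype τ X) v)) := by
  unfold messyL
  rw [List.mem_filter, proj_rep, realSt4_rep]
  exact ⟨mem_allTys _, admMessy_ftype τ X T {u} v⟩


end Real

end FourCopyHub

end Summit.CriticalPhenomena.PercolationContinuityZ3.Theorems

end
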